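import Literature.AlgebraicGeometry.Frobenioids.PadicFrobenioidSelfEquivalenceRigid
import Literature.IUT.HodgeTheaters.Cor53iiAtPadicFrobenioid
import Literature.IUT.HodgeTheaters.Cor53iiAtGoodPlace
import Literature.IUT.HodgeTheaters.InitialThetaDataLocalSlim
import HarnessLib

/-!
# [IUTchI] Cor 5.3 (ii) at the GENUINE good non-archimedean place: the injectivity input `hker` of
# `Cor53iiAtGoodPlace` REDUCED to the single unit-transport law `hO` — every side condition discharged (proof-only)

S. Mochizuki, *Inter-universal Teichmüller theory I*, kurims manuscript (May 2020), §5 Corollary 5.3 (ii) p. 144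
l. 14–18 («the natural map `Isom(¹𝔉, ²𝔉) → Isom(¹𝔇, ²𝔇)` is bijective»), proof p. 144 l. 41–45 («… it remains to verify
injectivity … let `α ∈ Ker` … [we may suppose that] `α` lies over the identity … `α` is [isomorphic to] the identity»);
Example 3.3 (i) p. 77 («`Φ_{𝒞_v} : Spec(L) ↦ ord(𝒪^▷_L)^pf`», «`𝒞_v` … `p_v`-adic Frobenioid … base category `𝒟_v`»)
([IUTchI] Cor 5.3 (ii) p.144) [claim: Mochizuki2012, status: disputed] (D-0012 claim key; nothing of the series is
asserted; no side taken on [IUTchIII] Cor. 3.12).  S. Mochizuki, *The geometry of Frobenioids I*, Kyushu J. Math. **62**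
(2008), Thm. 5.2 (iv) p. 102, Prop. 5.6 p. 105 [cite: MochizukiFrdI2008, Thm. 5.2(iv) p.102]; *The geometry of
Frobenioids II*, Ex. 1.1 (ii) p. 8 [cite: MochizukiFrdII2008, Ex 1.1 (ii) p.8].

PROOF-ONLY knit (cell abc-iut, seat abc-iut-L1-d6; L5 row R63 «C53II-S2E-SIDECONDS@GOOD», L5-lead RULINGS #125 (2); sequel of
abc-iut-L1-t7's S2′/S2c chain p491743 → … → p498711 → p500370 → p500903).  abc-iut-L1-t7's
`PadicFrd.Datum.nonempty_iso_id_of_liesUnder_refl_of_endUnits` reduces the `hker` input of abc-iut-L5-t4's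
`Cor53.cosetCat_descend_injective_of_kernel_trivial` at a `p`-adic Frobenioid to the binders {`hD` FSM-type base, `hsl`
slim base, `hint` (INT), `hpf` (PF), `hΦ` rank one, `hdeg`, `hO`}.  Here EVERY binder but the slimness and the ONE law
`hO` is DISCHARGED at the carriers of record:
* §1 at ANY datum `d : PadicFrd.Datum D p`: `hΦ` is a CONSEQUENCE of the datum's own field `d.isMonoprime` ([FrdII] Ex. 1.1
  (ii) «monoprime subfunctor in monoids»; `IsMonoprime.dvd_or_dvd`), `hdeg` is abc-iut-L5-t4's `Cor53.padic_preservesDegFr`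
  ([FrdI] Cor. 4.11 (iv) at [FrdII] Ex. 1.1) — `padic_hker_of_endUnits` keeps {hD, hsl, hint, hpf, hO};
* §2 at the PERFECTION datum `PadicFrd.Datum.perf base hloc hc he` (`Φ = ord(𝒪^▷)^pf`, print's `Φ_{𝒞_v}` of Ex. 3.3 (i);
  the datum UNDER `GoodLocalFrobenioid.ofGalois` through abc-iut-L1-t4's `GoodLocalKit.CvOver`): `hint` is abc-iut-L1-t4's
  `Datum.perf_exists_ιHom_eq`, `hpf` is membership in the perfection — binders {hD, hsl, hO}; over a REAL coset base
  `ℬ(Π)⁰ = CosetCat Π`, `hD` is `CosetCat.isOfFSMType` ([FrdII] Ex. 1.3 (i)): `perf_cosetCat_hker_of_endUnits` = the `hker`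
  binder of `Cor53.cosetCat_descend_injective_of_kernel_trivial` at `Q := Datum.perf …` ⟸ {`IsSlim (CosetCat Π)`, hO};
* §3 the knit at the REAL `GoodLocalFrobenioid.ofGalois d aug hc hs ho Kv hp` and at the GENUINE place of the initial
  Θ-data `D.goodLocalFrobenioidOfEmb p k ι hX` (the §2/§3 shapes of `Cor53iiAtGoodPlace`): `Aut(𝒞_v̲) → Aut(𝒟_v̲)` is
  INJECTIVE modulo {`IsSlim (CosetCat Π_v̲)`} + LAW {hO} — or modulo {`IsSlimGroup Δ_C` = F-0004 (1)} + LAW {hO} for any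
  §0 binders — and BIJECTIVE (print's statement) modulo additionally FACT {hlift}.
THE LAW `hO` (verbatim shape of p500903; abc-iut-L1-t7's pen, row «C53ii/S2c»): every self-equivalence `Ψ` of `𝒞_v` fixes,
through every `η₀ : Ψ ⋙ Base ≅ Base`, the unit coordinate of every base-identity linear ENDOMORPHISM («the unit transport
of [FrdII] Thm. 2.4 induced by `Ψ` is the identity» = Kummer-pair rigidity [AbsTopIII] Prop. 3.2 (iv) at the place).  NOT
discharged here; FALSE at degenerate data (constant base functor: unit twists, abc-iut-L1-t7 05:06:52Z) — its discharge
lives at GENUINE data only.  Nothing of abc-iut-L1-t7's chain or of abc-iut-L5-t4's / abc-iut-w4-d109's / abc-iut-L5-t2's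
files is restated (consumed BY NAME); no new definition, instance, notation or Prop-valued fact; typed ≠ proved for
hO/hlift; no token flip is claimed by this file alone; nothing here bears on [IUTchIII] Cor. 3.12.
-/

-- `GoodLocalFrobenioid.ofGalois` fields / `ModelFrobenioid.data` unfold only at default transparency.
set_option backward.isDefEq.respectTransparency false

namespace Literature.IUT.HodgeTheaters

open CategoryTheory Opposite Literature.AlgebraicGeometry.Frobenioids Literature.AnabelianGeometry.SemiGraphs
open Literature.AlgebraicGeometry.Frobenioids.PadicFrd

universe v u

namespace Cor53

/-! ### §1. At ANY `p`-adic Frobenioid datum: `hΦ` (rank one) and `hdeg` discharged -/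

section AnyDatum

variable {D : Type u} [Category.{v} D] {p : ℕ} [Fact p.Prime] (d : PadicFrd.Datum D p)

/-- **`hΦ` DISCHARGED for every `p`-adic Frobenioid datum**: each `Φ(A)` is totally (pre)ordered by divisibility —
of any two elements one divides the other — because «`Φ ⊆ Φ₀|_D` is a monoprime subfunctor in monoids» (the datum's
field `isMonoprime`; `ℤ_{≥0}`, `ℚ_{≥0}`, `ℝ_{≥0}` are totally ordered). [cite: MochizukiFrdII2008, Ex 1.1 (ii) p.8] -/
theorem padic_rankOne (A : Dᵒᵖ) (z z' : d.Φ.obj A) : (∃ w, z = z' * w) ∨ (∃ w, z' = z * w) := by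
  rcases (d.isMonoprime A).dvd_or_dvd z' z with ⟨w, hw⟩ | ⟨w, hw⟩
  · exact Or.inl ⟨w, hw⟩
  · exact Or.inr ⟨w, hw⟩

/-- **Kernel triviality at ANY `p`-adic Frobenioid over a slim base of FSM-type with (INT)+(PF), modulo the single law
`hO`** (the `hker` currency of `Cor53iiAtGoodPlace` / `Cor53iiAtPadicFrobenioid`): abc-iut-L1-t7's
`PadicFrd.Datum.nonempty_iso_id_of_liesUnder_refl_of_endUnits` with its binders `hΦ` (`padic_rankOne`) and `hdeg`
(abc-iut-L5-t4's `Cor53.padic_preservesDegFr`, [FrdI] Cor. 4.11 (iv)) DISCHARGED — every self-equivalence lying under the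
identity of the base is `≅ 𝟭` as soon as the law `hO` holds. ([IUTchI] Cor 5.3 (ii) p.144) [claim: Mochizuki2012, status: disputed] -/
theorem padic_hker_of_endUnits (hD : IsOfFSMType D) (hsl : IsSlim D)
    (hint : ∀ (A : D) (a : OrdInt (d.fld A)), ∃ c : d.Φ.obj (op A), d.ιHom A c = Realification.of _ a)
    (hpf : ∀ (A : D) (c : d.Φ.obj (op A)), ∃ n : ℕ, 0 < n ∧ ∃ a : OrdInt (d.fld A),
      d.ιHom A (c ^ n) = Realification.of _ a)
    (hO : ∀ (Ψ : d.frobenioid ≌ d.frobenioid)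
      (η₀ : Ψ.functor ⋙ ModelFrobenioid.baseFunctor d.Φ d.B d.divB ≅ ModelFrobenioid.baseFunctor d.Φ d.B d.divB)
      (X : d.frobenioid) (τ : X ⟶ X), ModelFrobenioid.degFr τ = 1 → ModelFrobenioid.baseMap τ = 𝟙 X.base →
      ModelFrobenioid.unit (Ψ.functor.map τ) =
        pull d.B (A := X.base) (B := (Ψ.functor.obj X).base) (η₀.hom.app X) (ModelFrobenioid.unit τ)) :
    ∀ Ψ : d.frobenioid ≌ d.frobenioid,
      Nonempty (CatIsomorphism.LiesUnder (ModelFrobenioid.baseFunctor d.Φ d.B d.divB)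
        (ModelFrobenioid.baseFunctor d.Φ d.B d.divB) Ψ (CategoryTheory.Equivalence.refl (C := D))) →
      Nonempty (Ψ.functor ≅ 𝟭 d.frobenioid) :=
  fun Ψ ⟨h⟩ => d.nonempty_iso_id_of_liesUnder_refl_of_endUnits hD hsl hint hpf (padic_rankOne d) Ψ h
    (padic_preservesDegFr d hD hsl Ψ) (hO Ψ)

end AnyDatum

/-! ### §2. At the PERFECTION datum `Φ = ord(𝒪^▷)^pf` ([IUTchI] Ex 3.3 (i) `Φ_{𝒞_v}`): `hint`, `hpf` discharged -/

section Perfection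

variable {D : Type u} [Category.{v} D] {p : ℕ} [Fact p.Prime] (base : D ⥤ PadicFld.{u} p)
  (hloc : ∀ A : D, (base.obj A).IsPadicLocal) (hc : IsConnected D) (he : IsTotallyEpimorphic D)

/-- **(PF) DISCHARGED at the perfection datum**: every element of `Φ(A) = ord(𝒪^▷_{K_A})^pf` has a positive power in
`ord(𝒪^▷_{K_A}) ⊗ 1` — the definition of the perfection (`Realification.mem_perf_iff`). [cite: MochizukiFrdII2008, Ex 1.1 (ii) p.8] -/
theorem perf_exists_pow_ιHom_eq (A : D) (c : (Datum.perf base hloc hc he).Φ.obj (op A)) :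
    ∃ n : ℕ, 0 < n ∧ ∃ a : OrdInt ((Datum.perf base hloc hc he).fld A),
      (Datum.perf base hloc hc he).ιHom A (c ^ n) = Realification.of _ a := by
  obtain ⟨n, hn, a, ha⟩ := (Realification.mem_perf_iff _).mp c.2
  exact ⟨n, hn, a, ha.symm⟩

/-- **Kernel triviality at the `p`-adic Frobenioid of the PERFECTION** `Φ = ord(𝒪^▷)^pf` over a slim base of FSM-type,
**modulo the single law `hO`**: (INT) is abc-iut-L1-t4's `Datum.perf_exists_ιHom_eq`, (PF) is
`perf_exists_pow_ιHom_eq`, rank one and `hdeg` as in §1. ([IUTchI] Cor 5.3 (ii) p.144) [claim: Mochizuki2012, status: disputed] -/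
theorem perf_hker_of_endUnits (hD : IsOfFSMType D) (hsl : IsSlim D)
    (hO : ∀ (Ψ : (Datum.perf base hloc hc he).frobenioid ≌ (Datum.perf base hloc hc he).frobenioid)
      (η₀ : Ψ.functor ⋙ ModelFrobenioid.baseFunctor (Datum.perf base hloc hc he).Φ (Datum.perf base hloc hc he).B
          (Datum.perf base hloc hc he).divB ≅
        ModelFrobenioid.baseFunctor (Datum.perf base hloc hc he).Φ (Datum.perf base hloc hc he).B
          (Datum.perf base hloc hc he).divB)
      (X : (Datum.perf base hloc hc he).frobenioid) (τ : X ⟶ X),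
      ModelFrobenioid.degFr τ = 1 → ModelFrobenioid.baseMap τ = 𝟙 X.base →
      ModelFrobenioid.unit (Ψ.functor.map τ) =
        pull (Datum.perf base hloc hc he).B (A := X.base) (B := (Ψ.functor.obj X).base) (η₀.hom.app X)
          (ModelFrobenioid.unit τ)) :
    ∀ Ψ : (Datum.perf base hloc hc he).frobenioid ≌ (Datum.perf base hloc hc he).frobenioid,
      Nonempty (CatIsomorphism.LiesUnder
        (ModelFrobenioid.baseFunctor (Datum.perf base hloc hc he).Φ (Datum.perf base hloc hc he).B
          (Datum.perf base hloc hc he).divB)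
        (ModelFrobenioid.baseFunctor (Datum.perf base hloc hc he).Φ (Datum.perf base hloc hc he).B
          (Datum.perf base hloc hc he).divB) Ψ (CategoryTheory.Equivalence.refl (C := D))) →
      Nonempty (Ψ.functor ≅ 𝟭 (Datum.perf base hloc hc he).frobenioid) :=
  padic_hker_of_endUnits (Datum.perf base hloc hc he) hD hsl (Datum.perf_exists_ιHom_eq base hloc hc he)
    (perf_exists_pow_ιHom_eq base hloc hc he) hO

end Perfection

/-! ### §2b. Over a REAL coset base `ℬ(Π)⁰ = CosetCat Π`: `hD` discharged — the `hker` binder of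
`Cor53.cosetCat_descend_injective_of_kernel_trivial` at the perfection datum ⟸ `hO` alone -/

section CosetBase

variable {P : Type u} [Group P] [TopologicalSpace P] [IsTopologicalGroup P] {p : ℕ} [Fact p.Prime]
  (base : CosetCat P ⥤ PadicFld.{u} p) (hloc : ∀ A : CosetCat P, (base.obj A).IsPadicLocal)
  (hc : IsConnected (CosetCat P)) (he : IsTotallyEpimorphic (CosetCat P))

/-- **Over a slim REAL coset base `ℬ(Π)⁰`, the `hker` binder of `Cor53.cosetCat_descend_injective_of_kernel_trivial`
at the perfection datum `Q := Datum.perf base hloc hc he` (`Φ_{𝒞_v} = ord(𝒪^▷)^pf`; any witnesses `hc`/`he`, e.g.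
`CosetCat.isConnected`/`CosetCat.isTotallyEpimorphic` as under `GoodLocalFrobenioid.ofGalois`) HOLDS as soon as the law
`hO` does** — FSM-type is `CosetCat.isOfFSMType` ([FrdII] Ex. 1.3 (i)), everything else §1–§2; the only remaining
by-name binder is `IsSlim (CosetCat Π)`.
([IUTchI] Cor 5.3 (ii) p.144) [claim: Mochizuki2012, status: disputed] -/
theorem perf_cosetCat_hker_of_endUnits (hsl : IsSlim (CosetCat P))
    (hO : ∀ (Ψ : (Datum.perf base hloc hc he).frobenioid ≌
        (Datum.perf base hloc hc he).frobenioid)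
      (η₀ : Ψ.functor ⋙ ModelFrobenioid.baseFunctor
          (Datum.perf base hloc hc he).Φ
          (Datum.perf base hloc hc he).B
          (Datum.perf base hloc hc he).divB ≅
        ModelFrobenioid.baseFunctor
          (Datum.perf base hloc hc he).Φ
          (Datum.perf base hloc hc he).B
          (Datum.perf base hloc hc he).divB)
      (X : (Datum.perf base hloc hc he).frobenioid) (τ : X ⟶ X),
      ModelFrobenioid.degFr τ = 1 → ModelFrobenioid.baseMap τ = 𝟙 X.base →
      ModelFrobenioid.unit (Ψ.functor.map τ) =
        pull (Datum.perf base hloc hc he).B (A := X.base)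
          (B := (Ψ.functor.obj X).base) (η₀.hom.app X) (ModelFrobenioid.unit τ)) :
    ∀ Ψ : (Datum.perf base hloc hc he).frobenioid ≌
        (Datum.perf base hloc hc he).frobenioid,
      Nonempty (CatIsomorphism.LiesUnder
        (ModelFrobenioid.baseFunctor
          (Datum.perf base hloc hc he).Φ
          (Datum.perf base hloc hc he).B
          (Datum.perf base hloc hc he).divB)
        (ModelFrobenioid.baseFunctor
          (Datum.perf base hloc hc he).Φ
          (Datum.perf base hloc hc he).B
          (Datum.perf base hloc hc he).divB)
        Ψ (CategoryTheory.Equivalence.refl (C := CosetCat P))) →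
      Nonempty (Ψ.functor ≅ 𝟭 _) :=
  perf_hker_of_endUnits base hloc hc he CosetCat.isOfFSMType hsl hO

end CosetBase

/-! ### §3. The knit at the REAL `GoodLocalFrobenioid.ofGalois` and at the GENUINE good place of the initial Θ-data -/

section OfGalois

variable {p : ℕ} [Fact p.Prime] (d : GaloisValDatum.{u} p) {P : Type u} [Group P] [TopologicalSpace P]
  [IsTopologicalGroup P] (aug : P →* d.Gal) (hc : Continuous aug) (hs : Function.Surjective aug) (ho : IsOpenMap aug)
  (Kv : Type) [Field Kv] [ValuativeRel Kv] (hp : ((p : Kv)) ∈ PadicFrd.intNonzero Kv)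

variable (hsl : IsSlim (CosetCat P))
  (hO : ∀ (Ψ : (Datum.perf (GoodLocalFrobenioid.galoisBaseV d aug ho) (GoodLocalFrobenioid.galoisBaseV_isPadicLocal d aug ho)
          CosetCat.isConnected CosetCat.isTotallyEpimorphic).frobenioid ≌
        (Datum.perf (GoodLocalFrobenioid.galoisBaseV d aug ho) (GoodLocalFrobenioid.galoisBaseV_isPadicLocal d aug ho)
          CosetCat.isConnected CosetCat.isTotallyEpimorphic).frobenioid)
      (η₀ : Ψ.functor ⋙ ModelFrobenioid.baseFunctor (Datum.perf (GoodLocalFrobenioid.galoisBaseV d aug ho) (GoodLocalFrobenioid.galoisBaseV_isPadicLocal d aug ho)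
          CosetCat.isConnected CosetCat.isTotallyEpimorphic).Φ (Datum.perf (GoodLocalFrobenioid.galoisBaseV d aug ho) (GoodLocalFrobenioid.galoisBaseV_isPadicLocal d aug ho)
          CosetCat.isConnected CosetCat.isTotallyEpimorphic).B (Datum.perf (GoodLocalFrobenioid.galoisBaseV d aug ho) (GoodLocalFrobenioid.galoisBaseV_isPadicLocal d aug ho)
          CosetCat.isConnected CosetCat.isTotallyEpimorphic).divB ≅
        ModelFrobenioid.baseFunctor (Datum.perf (GoodLocalFrobenioid.galoisBaseV d aug ho) (GoodLocalFrobenioid.galoisBaseV_isPadicLocal d aug ho)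
          CosetCat.isConnected CosetCat.isTotallyEpimorphic).Φ (Datum.perf (GoodLocalFrobenioid.galoisBaseV d aug ho) (GoodLocalFrobenioid.galoisBaseV_isPadicLocal d aug ho)
          CosetCat.isConnected CosetCat.isTotallyEpimorphic).B (Datum.perf (GoodLocalFrobenioid.galoisBaseV d aug ho) (GoodLocalFrobenioid.galoisBaseV_isPadicLocal d aug ho)
          CosetCat.isConnected CosetCat.isTotallyEpimorphic).divB)
      (X : (Datum.perf (GoodLocalFrobenioid.galoisBaseV d aug ho) (GoodLocalFrobenioid.galoisBaseV_isPadicLocal d aug ho)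
          CosetCat.isConnected CosetCat.isTotallyEpimorphic).frobenioid) (τ : X ⟶ X),
      ModelFrobenioid.degFr τ = 1 → ModelFrobenioid.baseMap τ = 𝟙 X.base →
      ModelFrobenioid.unit (Ψ.functor.map τ) =
        pull (Datum.perf (GoodLocalFrobenioid.galoisBaseV d aug ho) (GoodLocalFrobenioid.galoisBaseV_isPadicLocal d aug ho)
          CosetCat.isConnected CosetCat.isTotallyEpimorphic).B (A := X.base) (B := (Ψ.functor.obj X).base) (η₀.hom.app X) (ModelFrobenioid.unit τ))

include hsl hO in
/-- **Cor 5.3 (ii) model case, INJECTIVITY, at the REAL `𝒞_v = (ofGalois d aug …).Cv` over `𝒟_v = ℬ(Π_v)⁰`, modulo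
{`IsSlim (CosetCat Π_v)`} + the ONE law `hO`** (stated on the datum UNDER `ofGalois`: the perfection datum of the field
functor `Π_v/U ↦ Ω^{aug(U)}`, `GoodLocalFrobenioid.galoisBaseV`): the natural map `Aut(𝒞_v) → Aut(𝒟_v)` (binders
discharged by abc-iut-w4-d109) is injective. ([IUTchI] Cor 5.3 (ii) p.144) [claim: Mochizuki2012, status: disputed] -/
theorem ofGalois_descend_injective_of_endUnits :
    Function.Injective (CatIsomorphism.descend
      (GoodLocalFrobenioid.hasUnder_toBase_ofGalois d aug hc hs ho Kv hp d aug hc hs ho Kv hp hsl hsl)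
      (GoodLocalFrobenioid.underUnique_toBase_ofGalois d aug hc hs ho Kv hp d aug hc hs ho Kv hp hsl hsl)) :=
  CatIsomorphism.descend_injective_of_kernel_trivial _ _
    (perf_cosetCat_hker_of_endUnits (GoodLocalFrobenioid.galoisBaseV d aug ho)
      (GoodLocalFrobenioid.galoisBaseV_isPadicLocal d aug ho) CosetCat.isConnected CosetCat.isTotallyEpimorphic hsl hO)

include hsl hO in
/-- **Cor 5.3 (ii) model case AS PRINTED («bijective») at the REAL `𝒞_v = (ofGalois d aug …).Cv`**, modulo
{`IsSlim (CosetCat Π_v)`} + LAW {hO} (injectivity content) + FACT {hlift} (surjectivity: [AbsTopIII] Prop 3.2 (iv)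
bijectivity through the construction, F-0409 — BY NAME). ([IUTchI] Cor 5.3 (ii) p.144) [claim: Mochizuki2012, status: disputed] -/
theorem ofGalois_descendBijective_of_endUnits_of_lifts
    (hlift : ∀ Θ : CosetCat P ≌ CosetCat P,
      ∃ Ψ : (GoodLocalFrobenioid.ofGalois d aug hc hs ho Kv hp).Cv ≌ (GoodLocalFrobenioid.ofGalois d aug hc hs ho Kv hp).Cv,
        Nonempty (CatIsomorphism.LiesUnder (GoodLocalFrobenioid.ofGalois d aug hc hs ho Kv hp).toBase
          (GoodLocalFrobenioid.ofGalois d aug hc hs ho Kv hp).toBase Ψ Θ)) :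
    CatIsomorphism.DescendBijective (GoodLocalFrobenioid.ofGalois d aug hc hs ho Kv hp).toBase
      (GoodLocalFrobenioid.ofGalois d aug hc hs ho Kv hp).toBase
      (GoodLocalFrobenioid.hasUnder_toBase_ofGalois d aug hc hs ho Kv hp d aug hc hs ho Kv hp hsl hsl)
      (GoodLocalFrobenioid.underUnique_toBase_ofGalois d aug hc hs ho Kv hp d aug hc hs ho Kv hp hsl hsl) :=
  ⟨ofGalois_descend_injective_of_endUnits d aug hc hs ho Kv hp hsl hO,
    CatIsomorphism.descend_surjective_of_lifts _ _ hlift⟩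

end OfGalois

section GenuinePlace

universe uF vK

variable {F : Type uF} {K : Type vK} {Fbar : Type} [Field F] [NumberField F] [Field K] [NumberField K]
  [Algebra F K] [Field Fbar] [Algebra F Fbar] [Algebra K Fbar] [IsScalarTower F K Fbar] [Normal K Fbar]
  {E : WeierstrassCurve F} [E.IsElliptic] {l : ℕ} {Pb : BadPlacePredicates K}
  (D : InitialThetaData F K Fbar E l Pb) (p : ℕ) [Fact p.Prime]
  (k : Type) [NontriviallyNormedField k] [CompleteSpace k] [IsUltrametricDist k] [NormedAlgebra ℚ_[p] k]
  [FiniteDimensional ℚ_[p] k] [Algebra K k] (ι : Fbar →ₐ[K] AlgebraicClosure k) (hX : IsOpen (D.PiXarrow : Set D.PiC))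

variable (hsl : IsSlim (CosetCat (D.PiLoc D.PiXarrow (localToGF F k ι))))
  (hO : ∀ (Ψ : (Datum.perf
          (GoodLocalFrobenioid.galoisBaseV (GaloisValDatum.ofComplete p k) (D.augLoc D.PiXarrow (localToGF F k ι))
            (D.isOpenMap_augLoc D.PiXarrow (localToGF F k ι) hX (continuous_localToGF F k ι)))
          (GoodLocalFrobenioid.galoisBaseV_isPadicLocal (GaloisValDatum.ofComplete p k)
            (D.augLoc D.PiXarrow (localToGF F k ι))
            (D.isOpenMap_augLoc D.PiXarrow (localToGF F k ι) hX (continuous_localToGF F k ι)))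
          CosetCat.isConnected CosetCat.isTotallyEpimorphic).frobenioid ≌
        (Datum.perf
          (GoodLocalFrobenioid.galoisBaseV (GaloisValDatum.ofComplete p k) (D.augLoc D.PiXarrow (localToGF F k ι))
            (D.isOpenMap_augLoc D.PiXarrow (localToGF F k ι) hX (continuous_localToGF F k ι)))
          (GoodLocalFrobenioid.galoisBaseV_isPadicLocal (GaloisValDatum.ofComplete p k)
            (D.augLoc D.PiXarrow (localToGF F k ι))
            (D.isOpenMap_augLoc D.PiXarrow (localToGF F k ι) hX (continuous_localToGF F k ι)))
          CosetCat.isConnected CosetCat.isTotallyEpimorphic).frobenioid)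
      (η₀ : Ψ.functor ⋙ ModelFrobenioid.baseFunctor (Datum.perf
          (GoodLocalFrobenioid.galoisBaseV (GaloisValDatum.ofComplete p k) (D.augLoc D.PiXarrow (localToGF F k ι))
            (D.isOpenMap_augLoc D.PiXarrow (localToGF F k ι) hX (continuous_localToGF F k ι)))
          (GoodLocalFrobenioid.galoisBaseV_isPadicLocal (GaloisValDatum.ofComplete p k)
            (D.augLoc D.PiXarrow (localToGF F k ι))
            (D.isOpenMap_augLoc D.PiXarrow (localToGF F k ι) hX (continuous_localToGF F k ι)))
          CosetCat.isConnected CosetCat.isTotallyEpimorphic).Φ (Datum.perf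
          (GoodLocalFrobenioid.galoisBaseV (GaloisValDatum.ofComplete p k) (D.augLoc D.PiXarrow (localToGF F k ι))
            (D.isOpenMap_augLoc D.PiXarrow (localToGF F k ι) hX (continuous_localToGF F k ι)))
          (GoodLocalFrobenioid.galoisBaseV_isPadicLocal (GaloisValDatum.ofComplete p k)
            (D.augLoc D.PiXarrow (localToGF F k ι))
            (D.isOpenMap_augLoc D.PiXarrow (localToGF F k ι) hX (continuous_localToGF F k ι)))
          CosetCat.isConnected CosetCat.isTotallyEpimorphic).B (Datum.perf
          (GoodLocalFrobenioid.galoisBaseV (GaloisValDatum.ofComplete p k) (D.augLoc D.PiXarrow (localToGF F k ι))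
            (D.isOpenMap_augLoc D.PiXarrow (localToGF F k ι) hX (continuous_localToGF F k ι)))
          (GoodLocalFrobenioid.galoisBaseV_isPadicLocal (GaloisValDatum.ofComplete p k)
            (D.augLoc D.PiXarrow (localToGF F k ι))
            (D.isOpenMap_augLoc D.PiXarrow (localToGF F k ι) hX (continuous_localToGF F k ι)))
          CosetCat.isConnected CosetCat.isTotallyEpimorphic).divB ≅
        ModelFrobenioid.baseFunctor (Datum.perf
          (GoodLocalFrobenioid.galoisBaseV (GaloisValDatum.ofComplete p k) (D.augLoc D.PiXarrow (localToGF F k ι))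
            (D.isOpenMap_augLoc D.PiXarrow (localToGF F k ι) hX (continuous_localToGF F k ι)))
          (GoodLocalFrobenioid.galoisBaseV_isPadicLocal (GaloisValDatum.ofComplete p k)
            (D.augLoc D.PiXarrow (localToGF F k ι))
            (D.isOpenMap_augLoc D.PiXarrow (localToGF F k ι) hX (continuous_localToGF F k ι)))
          CosetCat.isConnected CosetCat.isTotallyEpimorphic).Φ (Datum.perf
          (GoodLocalFrobenioid.galoisBaseV (GaloisValDatum.ofComplete p k) (D.augLoc D.PiXarrow (localToGF F k ι))
            (D.isOpenMap_augLoc D.PiXarrow (localToGF F k ι) hX (continuous_localToGF F k ι)))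
          (GoodLocalFrobenioid.galoisBaseV_isPadicLocal (GaloisValDatum.ofComplete p k)
            (D.augLoc D.PiXarrow (localToGF F k ι))
            (D.isOpenMap_augLoc D.PiXarrow (localToGF F k ι) hX (continuous_localToGF F k ι)))
          CosetCat.isConnected CosetCat.isTotallyEpimorphic).B (Datum.perf
          (GoodLocalFrobenioid.galoisBaseV (GaloisValDatum.ofComplete p k) (D.augLoc D.PiXarrow (localToGF F k ι))
            (D.isOpenMap_augLoc D.PiXarrow (localToGF F k ι) hX (continuous_localToGF F k ι)))
          (GoodLocalFrobenioid.galoisBaseV_isPadicLocal (GaloisValDatum.ofComplete p k)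
            (D.augLoc D.PiXarrow (localToGF F k ι))
            (D.isOpenMap_augLoc D.PiXarrow (localToGF F k ι) hX (continuous_localToGF F k ι)))
          CosetCat.isConnected CosetCat.isTotallyEpimorphic).divB)
      (X : (Datum.perf
          (GoodLocalFrobenioid.galoisBaseV (GaloisValDatum.ofComplete p k) (D.augLoc D.PiXarrow (localToGF F k ι))
            (D.isOpenMap_augLoc D.PiXarrow (localToGF F k ι) hX (continuous_localToGF F k ι)))
          (GoodLocalFrobenioid.galoisBaseV_isPadicLocal (GaloisValDatum.ofComplete p k)
            (D.augLoc D.PiXarrow (localToGF F k ι))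
            (D.isOpenMap_augLoc D.PiXarrow (localToGF F k ι) hX (continuous_localToGF F k ι)))
          CosetCat.isConnected CosetCat.isTotallyEpimorphic).frobenioid) (τ : X ⟶ X),
      ModelFrobenioid.degFr τ = 1 → ModelFrobenioid.baseMap τ = 𝟙 X.base →
      ModelFrobenioid.unit (Ψ.functor.map τ) =
        pull (Datum.perf
          (GoodLocalFrobenioid.galoisBaseV (GaloisValDatum.ofComplete p k) (D.augLoc D.PiXarrow (localToGF F k ι))
            (D.isOpenMap_augLoc D.PiXarrow (localToGF F k ι) hX (continuous_localToGF F k ι)))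
          (GoodLocalFrobenioid.galoisBaseV_isPadicLocal (GaloisValDatum.ofComplete p k)
            (D.augLoc D.PiXarrow (localToGF F k ι))
            (D.isOpenMap_augLoc D.PiXarrow (localToGF F k ι) hX (continuous_localToGF F k ι)))
          CosetCat.isConnected CosetCat.isTotallyEpimorphic).B (A := X.base) (B := (Ψ.functor.obj X).base) (η₀.hom.app X) (ModelFrobenioid.unit τ))

include hsl hO in
/-- **[IUTchI] Cor 5.3 (ii), model case, INJECTIVITY, AT THE GENUINE PLACE `v̲ ∈ V̲^good ∩ V̲^non` of the initial
Θ-data** (`𝒞_v̲ := (D.goodLocalFrobenioidOfEmb p k ι hX).Cv` over `𝒟_v̲ = ℬ(Π_v̲)⁰`, `Π_v̲ := Π_{X̲→_v̲}` of Def 3.1 (f), every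
`K`-embedding `ι : F̄ → k̄`), **modulo {`IsSlim (CosetCat Π_v̲)`} and the ONE law `hO`** (stated on the datum under the carrier:
the perfection datum of `Π_v̲/U ↦ k̄^{aug(U)}`, `aug = D.augLoc …`), the §0 binders DISCHARGED (abc-iut-w4-d109) and EVERY side
condition of the rigidity chain (FSM-type, INT, PF, rank one, `deg_Fr`) DISCHARGED.  Binder census: by-name
{`IsSlim (CosetCat Π_v̲)`} · LAW {hO} · DATA {D, p, k, ι, hX}. ([IUTchI] Cor 5.3 (ii) p.144) [claim: Mochizuki2012, status: disputed] -/
theorem goodLocalFrobenioidOfEmb_descend_injective_of_endUnits :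
    letI := GaloisValDatum.normVal k
    Function.Injective (CatIsomorphism.descend
      (GoodLocalFrobenioid.hasUnder_toBase_ofGalois _ _ _ _ _ _ _ _ _ _ _ _ _ _ hsl hsl :
        CatIsomorphism.HasUnder (D.goodLocalFrobenioidOfEmb p k ι hX).toBase (D.goodLocalFrobenioidOfEmb p k ι hX).toBase)
      (GoodLocalFrobenioid.underUnique_toBase_ofGalois _ _ _ _ _ _ _ _ _ _ _ _ _ _ hsl hsl)) := by
  letI := GaloisValDatum.normVal k
  exact ofGalois_descend_injective_of_endUnits _ _ _ _ _ _ _ hsl hO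

include hsl hO in
/-- **[IUTchI] Cor 5.3 (ii), model case AS PRINTED («bijective»), AT THE GENUINE PLACE of the initial Θ-data**,
modulo {`IsSlim (CosetCat Π_v̲)`} + LAW {hO} (injectivity content: the [FrdI]/[FrdII] rigidity chain's single
residual law) + FACT {hlift} (surjectivity, [AbsTopIII] Prop 3.2 (iv) through the construction — BY NAME).
Binder census: by-name 1 · LAW 1 · FACT 1 · DATA {D, p, k, ι, hX}. ([IUTchI] Cor 5.3 (ii) p.144) [claim: Mochizuki2012, status: disputed] -/
theorem goodLocalFrobenioidOfEmb_descendBijective_of_endUnits_of_lifts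
    (hlift : letI := GaloisValDatum.normVal k
      ∀ Θ : CosetCat (D.PiLoc D.PiXarrow (localToGF F k ι)) ≌ CosetCat (D.PiLoc D.PiXarrow (localToGF F k ι)),
      ∃ Ψ : (D.goodLocalFrobenioidOfEmb p k ι hX).Cv ≌ (D.goodLocalFrobenioidOfEmb p k ι hX).Cv,
        Nonempty (CatIsomorphism.LiesUnder (D.goodLocalFrobenioidOfEmb p k ι hX).toBase
          (D.goodLocalFrobenioidOfEmb p k ι hX).toBase Ψ Θ)) :
    letI := GaloisValDatum.normVal k
    CatIsomorphism.DescendBijective (D.goodLocalFrobenioidOfEmb p k ι hX).toBase (D.goodLocalFrobenioidOfEmb p k ι hX).toBase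
      (GoodLocalFrobenioid.hasUnder_toBase_ofGalois _ _ _ _ _ _ _ _ _ _ _ _ _ _ hsl hsl)
      (GoodLocalFrobenioid.underUnique_toBase_ofGalois _ _ _ _ _ _ _ _ _ _ _ _ _ _ hsl hsl) := by
  letI := GaloisValDatum.normVal k
  unfold InitialThetaData.goodLocalFrobenioidOfEmb at hlift ⊢
  exact ofGalois_descendBijective_of_endUnits_of_lifts _ _ _ _ _ _ _ hsl hO hlift

include hO in
/-- **The same with the slimness binder traded for the FROZEN FACT's input**: modulo ONLY the slimness of the geometric
fundamental group `Δ_C` ([AbsAnab] Lem. 1.3.1 — the first conjunct of the frozen fact F-0004 `GeomAndArithSlim`, as in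
abc-iut-L5-t2's `dFromF_goodLocalFrobenioidOfEmb_of_geom_slim`) and the ONE law `hO`, the natural map
`Aut(𝒞_v̲) → Aut(𝒟_v̲)` is injective for EVERY choice of the §0 binders `he`/`hu` (which abc-iut-w4-d109's
`hasUnder_toBase_ofGalois` / `underUnique_toBase_ofGalois` inhabit at the slimness of `ℬ(Π_v̲)⁰`, itself the theorem
`isSlim_cosetCat_of_isSlimGroup ∘ isSlimGroup_PiLoc_PiXarrow_of_geom_slim` — `G_v̲` slim being a tree theorem).
Binder census: FACT-input {`IsSlimGroup D.DeltaC` = F-0004 (1)} · LAW {hO} · binders {he, hu} (inhabited) · DATA {D, p, k, ι, hX}.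
([IUTchI] Cor 5.3 (ii) p.144) [claim: Mochizuki2012, status: disputed] -/
theorem goodLocalFrobenioidOfEmb_descend_injective_of_endUnits_of_geom_slim (hΔ : IsSlimGroup D.DeltaC)
    (he : letI := GaloisValDatum.normVal k
      CatIsomorphism.HasUnder (D.goodLocalFrobenioidOfEmb p k ι hX).toBase (D.goodLocalFrobenioidOfEmb p k ι hX).toBase)
    (hu : letI := GaloisValDatum.normVal k
      CatIsomorphism.UnderUnique (D.goodLocalFrobenioidOfEmb p k ι hX).toBase (D.goodLocalFrobenioidOfEmb p k ι hX).toBase) :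
    Function.Injective (CatIsomorphism.descend he hu) := by
  letI := GaloisValDatum.normVal k
  haveI := GaloisValDatum.charZero p k
  haveI : CompactSpace (D.PiLoc D.PiXarrow (localToGF F k ι)) :=
    D.compactSpace_PiLoc D.PiXarrow (localToGF F k ι) hX (continuous_localToGF F k ι)
  exact CatIsomorphism.descend_injective_of_kernel_trivial he hu
    (perf_cosetCat_hker_of_endUnits _ _ CosetCat.isConnected CosetCat.isTotallyEpimorphic
      (PadicFrd.isSlim_cosetCat_of_isSlimGroup (D.isSlimGroup_PiLoc_PiXarrow_of_geom_slim p k hΔ ι hX)) hO)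

include hO in
/-- **F-0004 BY NAME**: the same consuming the frozen fact `GeomAndArithSlim D.geom.extF` ([AbsAnab] Lem. 1.3.1 «`Δ`, `Π`
slim»; only its first conjunct is used). Binder census: FACT {F-0004} · LAW {hO} · binders {he, hu} · DATA {D, p, k, ι, hX}.
([IUTchI] Cor 5.3 (ii) p.144) [claim: Mochizuki2012, status: disputed] -/
theorem goodLocalFrobenioidOfEmb_descend_injective_of_endUnits_of_geomAndArithSlim
    (h : Literature.AnabelianGeometry.AbsoluteAnabelian.FundamentalExtension.GeomAndArithSlim D.geom.extF)
    (he : letI := GaloisValDatum.normVal k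
      CatIsomorphism.HasUnder (D.goodLocalFrobenioidOfEmb p k ι hX).toBase (D.goodLocalFrobenioidOfEmb p k ι hX).toBase)
    (hu : letI := GaloisValDatum.normVal k
      CatIsomorphism.UnderUnique (D.goodLocalFrobenioidOfEmb p k ι hX).toBase (D.goodLocalFrobenioidOfEmb p k ι hX).toBase) :
    Function.Injective (CatIsomorphism.descend he hu) :=
  goodLocalFrobenioidOfEmb_descend_injective_of_endUnits_of_geom_slim D p k ι hX hO h.1 he hu

end GenuinePlace

end Cor53

end Literature.IUT.HodgeTheaters
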